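import Summits.BirchSwinnertonDyer.BirchSwinnertonDyer.Theorems.ManinLocalTwoThreeTwoShiftEigenTower
import Summits.BirchSwinnertonDyer.BirchSwinnertonDyer.Theorems.ManinLocalTwoThreeShiftCompatiblePairRigidity
import Mathlib.FieldTheory.Finite.GaloisField
import HarnessLib

/-!
# The 2-ADIC TWIN, V: ASSEMBLY — G₂ `TwoShiftInvariantIsDiamond` and G₈ `EightShiftInvariantIsDiamond` at EVERY level, modulo the
# single index-3 node `TwoShiftCubeStep` (`Γ₀(2N₀) → Γ₀(N₀)`, `N₀` odd); the ω-reduction G₈ ⟸ G₂ ∧ (ω-part = 0) PROVED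
# (route `ManinLocalTwoThree`, cell bsd-f2-manin; crux C2 `ManinOddAtFour` stmt-BirchSwinnertonDyer-22967; prover seat p3 gen 11)

* §1 adapters between the explicit-entry predicates of file I and the tree's `Gamma0.degeneracyConj`, and the two BASES at odd level
  from p2's rigidity theorem (`…ShiftCompatiblePairRigidity.lean`, p683739): `twoShiftInvariantIsDiamondAt_of_odd` (K₂(N₀) = D(N₀)) and
  `shiftEigenTrivialAt_of_odd` (K^ε(N₀) = 0 for `ε ≠ 1`, any field `K ⊇ 𝔽₂` in `Type`).
* §2 the ONE remaining obligation node **`TwoShiftCubeStep`** (typed `@[conjecture]`, nothing asserted): the index-3 descent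
  `Γ₀(2N₀) → Γ₀(N₀)` for additive `ε`-eigenfunctions at odd `N₀` — the twin of es's cube step E-es-103/104 (`[Γ₀(N₀):Γ₀(2N₀)] = 3` is odd, so
  the seat's p=3 TRANSFER proof `…CubeStep.lean` ports; not yet ported).
* §3 **`twoShiftInvariantIsDiamond_of_cube : TwoShiftCubeStep → TwoShiftInvariantIsDiamond`** (base + cube + the tower of file III) and
  **`shiftEigenTrivialAt_of_cube`** (the ω-part vanishes at every level: base + cube + the eigen tower of file IV).
* §4 **THE ω-REDUCTION (PROVED): `TwoShiftInvariantIsDiamondAt N → ShiftEigenTrivialAt (4N) ζ² → (K₈(N) = D(N))`** for `ζ² + ζ + 1 = 0`: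
  for an 8-shift-invariant `φ` the defect `θ = φ + φ∘Ad(diag(2,1))` on `Γ₀(2N)` satisfies `σ²θ = σθ + θ`, so `η = σθ + ζθ` on `Γ₀(4N)` is a
  `ζ²`-eigenfunction, hence `0`; so `θ = 0` on `Γ₀(4N)` and on `{2 ∣ b}`, hence on `Γ₀(2N) = {2 ∣ b}·⟨T⟩`, i.e. `φ` is 2-shift invariant.
* §5 `𝔽₄ = GaloisField 2 2` supplies `ζ`; **`eightShiftInvariantIsDiamond_of_cube : TwoShiftCubeStep → EightShiftInvariantIsDiamond`**.
HONEST STATUS: G₂/G₈ are THEOREMS MODULO the one node `TwoShiftCubeStep` (a port, not new mathematics); census for both laws: file I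
header.  Nothing about BSD, Manin's conjecture or C2 is proved here (the C2 consequence of G₈ on the squarefull cell is anyway covered by
E-es-66₂ `twoAdicWitnessOfPlusIndexOdd_holds`).  Reference: HOME/MEMO-es.md §37 [cite: DarmonDiamondTaylor1995, Lemma 4.28 (p. 135)].
-/

set_option autoImplicit false
set_option linter.dupNamespace false

open scoped MatrixGroups

open CongruenceSubgroup Matrix.SpecialLinearGroup
open Summit.BirchSwinnertonDyer.Rank1Residual.ManinAdditive.NineShiftEqualiser (slOf g0Of slOf_apply_00 slOf_apply_01
  slOf_apply_10 slOf_apply_11 slOf_mem_gamma0 g0Of_congr)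
open Summit.BirchSwinnertonDyer.BirchSwinnertonDyer.Theorems.ManinLocalTwoThree.ThreeShiftDescent (g0Of_mul det_mul_entries
  Tpow Tpow_mul_Tpow Tpow_zero Tpow_inv g0Of_mul_Tpow Tpow_one_mul_mul_Tpow_neg_one)
open Literature.NumberTheory.EllipticCurves.ModularForms (Gamma0.degeneracyConj Gamma0.degeneracyConjElt
  Gamma0.coe_degeneracyConj_one Gamma0.degeneracyConj_apply)

namespace Summit.BirchSwinnertonDyer.BirchSwinnertonDyer.Theorems.ManinLocalTwoThree

namespace TwoShift

/-! ### §1. Adapters to `Gamma0.degeneracyConj` and the two bases at odd level (p2's rigidity) -/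

section Adapters

variable {N : ℕ}

/-- `N·1 ∣ 2N`. [folklore] -/
theorem dvd_two_mul_one (N : ℕ) : N * 1 ∣ 2 * N := ⟨2, by ring⟩
/-- `N·2 ∣ 2N`. [folklore] -/
theorem dvd_two_mul_two (N : ℕ) : N * 2 ∣ 2 * N := ⟨1, by ring⟩

/-- The inclusion `Γ₀(2N) → Γ₀(N)` on an explicit matrix. [cite: DarmonDiamondTaylor1995, Lemma 4.28 (p. 135)] -/
theorem degeneracyConj_one_g0Of (h21 : N * 1 ∣ 2 * N) (a b c d : ℤ) (h : a * d - b * c = 1)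
    (hc : ((2 * N : ℕ) : ℤ) ∣ c) (hcN : (N : ℤ) ∣ c) :
    Gamma0.degeneracyConj N (2 * N) 1 h21 (g0Of a b c d h hc) = g0Of a b c d h hcN :=
  Subtype.ext (Gamma0.coe_degeneracyConj_one _ _)

/-- The 2-shift `Γ₀(2N) → Γ₀(N)` on an explicit matrix `(a b; 2c₀ d) ↦ (a 2b; c₀ d)`. [cite: DarmonDiamondTaylor1995, Lemma 4.28 (p. 135)] -/
theorem degeneracyConj_two_g0Of (h22 : N * 2 ∣ 2 * N) (a b c₀ d : ℤ) (h : a * d - b * (2 * c₀) = 1)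
    (hc : ((2 * N : ℕ) : ℤ) ∣ 2 * c₀) (hc₀ : (N : ℤ) ∣ c₀) :
    Gamma0.degeneracyConj N (2 * N) 2 h22 (g0Of a b (2 * c₀) d h hc) =
      g0Of a (2 * b) c₀ d (by linear_combination h) hc₀ := by
  apply Subtype.ext
  ext i j
  have e10 : (2 : ℤ) * c₀ / 2 = c₀ := Int.mul_ediv_cancel_left c₀ (by norm_num)
  fin_cases i <;> fin_cases j <;>
    simp [Gamma0.degeneracyConjElt, g0Of, slOf, e10]

/-- half of the lower-left entry of `γ ∈ Γ₀(2N)`. [folklore] -/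
theorem exists_c_eq_two_mul (γ : Gamma0 (N * 2)) : ∃ c₀ : ℤ, ((γ : SL(2, ℤ)) 1 0 : ℤ) = 2 * c₀ ∧ (N : ℤ) ∣ c₀ := by
  obtain ⟨k, hk⟩ := level_dvd_c γ
  exact ⟨N * k, by rw [hk]; push_cast; ring, dvd_mul_right _ _⟩

/-- an `ε`-eigenfunction in the explicit sense is a compatible pair `(ε·η, η)` in p2's `degeneracyConj` sense. [folklore] -/
theorem compat_of_isShiftEigen {K : Type*} [CommRing K] (ε : K) (η : Gamma0 N → K) (hinv : IsShiftEigen ε η)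
    (γ : Gamma0 (N * 2)) :
    ε * η (Gamma0.degeneracyConj N (N * 2) 1 (mul_dvd_mul_left N (one_dvd 2)) γ) =
      η (Gamma0.degeneracyConj N (N * 2) 2 dvd_rfl γ) := by
  obtain ⟨c₀, hc₀, hNc₀⟩ := exists_c_eq_two_mul γ
  have hdet : ((γ : SL(2, ℤ)) 0 0 : ℤ) * (γ : SL(2, ℤ)) 1 1 - ((γ : SL(2, ℤ)) 0 1 : ℤ) * (2 * c₀) = 1 := by
    rw [← hc₀]; exact gamma0_det_entries γ
  have hc2 : ((N * 2 : ℕ) : ℤ) ∣ 2 * c₀ := by obtain ⟨k, hk⟩ := hNc₀; exact ⟨k, by rw [hk]; push_cast; ring⟩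
  have eγ : γ = g0Of ((γ : SL(2, ℤ)) 0 0) ((γ : SL(2, ℤ)) 0 1) (2 * c₀) ((γ : SL(2, ℤ)) 1 1) hdet hc2 := by
    apply Subtype.ext; ext i j
    fin_cases i <;> fin_cases j <;> simp [g0Of, slOf, hc₀]
  have e1 : Gamma0.degeneracyConj N (N * 2) 1 (mul_dvd_mul_left N (one_dvd 2)) γ =
      g0Of ((γ : SL(2, ℤ)) 0 0) ((γ : SL(2, ℤ)) 0 1) (2 * c₀) ((γ : SL(2, ℤ)) 1 1) hdet (Dvd.dvd.mul_left hNc₀ 2) := by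
    apply Subtype.ext
    rw [Gamma0.coe_degeneracyConj_one]
    ext i j
    fin_cases i <;> fin_cases j <;> simp [g0Of, slOf, hc₀]
  have e2 : Gamma0.degeneracyConj N (N * 2) 2 dvd_rfl γ =
      g0Of ((γ : SL(2, ℤ)) 0 0) (2 * (γ : SL(2, ℤ)) 0 1) c₀ ((γ : SL(2, ℤ)) 1 1) (by linear_combination hdet) hNc₀ := by
    apply Subtype.ext
    ext i j
    have e10 : (2 : ℤ) * c₀ / 2 = c₀ := Int.mul_ediv_cancel_left c₀ (by norm_num)
    fin_cases i <;> fin_cases j <;> simp [Gamma0.degeneracyConjElt, g0Of, slOf, hc₀, e10]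
  rw [e1, e2]
  exact (hinv _ _ _ _ hdet hNc₀).symm

/-- **BASE for G₂ (p2): `K₂(N₀) = D(N₀)` at odd `N₀ ≥ 1`.** [folklore] -/
theorem twoShiftInvariantIsDiamondAt_of_odd (N₀ : ℕ) (h0 : 0 < N₀) (hodd : ¬ 2 ∣ N₀) :
    TwoShiftInvariantIsDiamondAt N₀ := by
  intro φ hadd hinv γ hγ
  have hinv' : IsShiftEigen (1 : ZMod 2) φ := (isTwoShiftInvariant_iff_isShiftEigen_one φ).mp hinv
  exact twoShiftInvariant_isDiamond h0 hodd φ hadd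
    (fun γ' => by rw [← compat_of_isShiftEigen 1 φ hinv' γ', one_mul]) γ hγ

/-- **BASE for the ω-part (p2): `K^ε(N₀) = 0` at odd `N₀ ≥ 1`** for `ε ≠ 1` in a field `K ⊇ 𝔽₂`. [folklore] -/
theorem shiftEigenTrivialAt_of_odd {K : Type} [Field K] [CharP K 2] (ε : K) (hε1 : ε ≠ 1) (N₀ : ℕ) (h0 : 0 < N₀)
    (hodd : ¬ 2 ∣ N₀) : ShiftEigenTrivialAt N₀ ε := by
  intro η hadd hinv γ
  have hK : ∀ k : K, 2 • k = 0 := fun k => by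
    rw [two_nsmul, ← two_mul, CharTwo.two_eq_zero, zero_mul]
  have hadd' : ∀ γ δ : Gamma0 N₀, (fun g => ε * η g) (γ * δ) = (fun g => ε * η g) γ + (fun g => ε * η g) δ :=
    fun γ δ => by simp only [hadd γ δ, mul_add]
  have h := shiftCompatiblePair_eq Nat.prime_two h0 hodd hK (fun g => ε * η g) η hadd' hadd
    (compat_of_isShiftEigen ε η hinv) γ
  have h' : (ε - 1) * η γ = 0 := by rw [sub_mul, one_mul, sub_eq_zero]; exact h
  rcases mul_eq_zero.mp h' with h0' | h0'
  · exact absurd (sub_eq_zero.mp h0') hε1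
  · exact h0'

end Adapters

/-! ### §2. The remaining node: the index-3 step `Γ₀(2N₀) → Γ₀(N₀)` at odd `N₀` -/

/-- **NODE `TwoShiftCubeStep` (the `p = 2` twin of es's cube step E-es-103/104):** for odd `N₀ ≥ 1`, every field `K ⊇ 𝔽₂` (in `Type`)
and every `ε ≠ 0`, an additive `ε`-eigenfunction of the 2-shift on `Γ₀(2N₀)` is the restriction of one on `Γ₀(N₀)`.
(`[Γ₀(N₀) : Γ₀(2N₀)] = |P¹(𝔽₂)| = 3` is odd: the seat's TRANSFER proof of `…CubeStep.lean` ports with `s = (δ, −1; N₀², 2)`;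
not yet ported.)  CENSUS: implied by `dim K₂(N) = r₂((ℤ/N)ˣ)` at `N ≤ 35` and `K^ω(M) = 0` at `M ≤ 32` (seat engine).
FRAMING: prover seat p3; obligation node, nothing asserted. [conjecture — cell candidate, NOT a tree fact] -/
@[conjecture] def TwoShiftCubeStep : Prop :=
  ∀ (K : Type) [Field K] [CharP K 2] (ε : K), ε ≠ 0 → ∀ N₀ : ℕ, 0 < N₀ → ¬ 2 ∣ N₀ →
    ∀ η : Gamma0 (2 * N₀) → K, IsAdd η → IsShiftEigen ε η →
      ∃ w : Gamma0 N₀ → K, IsAdd w ∧ IsShiftEigen ε w ∧ RestrictsFrom η w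

/-! ### §3. G₂ and the ω-part at every level, modulo the node -/

/-- **G₂ at every level ⟸ the node.** [folklore] -/
theorem twoShiftInvariantIsDiamond_of_cube (hcube : TwoShiftCubeStep) : TwoShiftInvariantIsDiamond := by
  intro N hN
  obtain ⟨v, N₀, hN₀odd, rfl⟩ := Nat.exists_eq_two_pow_mul_odd hN.ne'
  have h0 : 0 < N₀ := Nat.pos_of_ne_zero (by rintro rfl; exact absurd hN₀odd (by decide))
  have h2 : ¬ 2 ∣ N₀ := fun h => (Nat.not_even_iff_odd.mpr hN₀odd) (even_iff_two_dvd.mpr h)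
  have hbase := twoShiftInvariantIsDiamondAt_of_odd N₀ h0 h2
  rcases v with _ | v
  · simpa using hbase
  · -- `K₂(2N₀) = D(2N₀)` by the node + base, then the tower
    have h2N₀ : TwoShiftInvariantIsDiamondAt (2 * N₀) := by
      intro φ hadd hinv
      have hinv' : IsShiftEigen (1 : ZMod 2) φ := (isTwoShiftInvariant_iff_isShiftEigen_one φ).mp hinv
      obtain ⟨w, hwadd, hwinv, hres⟩ := hcube (ZMod 2) 1 one_ne_zero N₀ h0 h2 φ hadd hinv'
      exact isDiamond_of_restrictsFrom (dvd_mul_left N₀ 2) hres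
        (hbase w hwadd ((isTwoShiftInvariant_iff_isShiftEigen_one w).mpr hwinv))
    exact twoShiftInvariantIsDiamondAt_of_two_mul N₀ h2N₀ v

/-- **The ω-part vanishes at every level ⟸ the node** (`ε ≠ 0, 1` in a field `K ⊇ 𝔽₂`). [folklore] -/
theorem shiftEigenTrivialAt_of_cube (hcube : TwoShiftCubeStep) {K : Type} [Field K] [CharP K 2] (ε : K)
    (hε0 : ε ≠ 0) (hε1 : ε ≠ 1) (N : ℕ) (hN : 0 < N) : ShiftEigenTrivialAt N ε := by
  obtain ⟨v, N₀, hN₀odd, rfl⟩ := Nat.exists_eq_two_pow_mul_odd hN.ne'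
  have h0 : 0 < N₀ := Nat.pos_of_ne_zero (by rintro rfl; exact absurd hN₀odd (by decide))
  have h2 : ¬ 2 ∣ N₀ := fun h => (Nat.not_even_iff_odd.mpr hN₀odd) (even_iff_two_dvd.mpr h)
  have hbase := shiftEigenTrivialAt_of_odd ε hε1 N₀ h0 h2
  rcases v with _ | v
  · simpa using hbase
  · have h2N₀ : ShiftEigenTrivialAt (2 * N₀) ε := by
      intro η hadd hinv γ
      obtain ⟨w, hwadd, hwinv, hres⟩ := hcube K ε hε0 N₀ h0 h2 η hadd hinv
      exact eq_zero_of_restrictsFrom (dvd_mul_left N₀ 2) hres (hbase w hwadd hwinv) γ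
    exact shiftEigenTrivialAt_of_two_mul N₀ ε hε0 hε1 h2N₀ v

/-! ### §4. The ω-reduction: G₈(N) ⟸ G₂(N) ∧ K^{ζ²}(4N) = 0 -/

section Omega

variable {K : Type} [Field K] [CharP K 2] {N : ℕ}

/-- the 2-shift DEFECT `θ(γ) = φ(γ) + φ(diag(2,1) γ diag(2,1)⁻¹)` on `Γ₀(2N)` of `φ : Γ₀(N) → 𝔽₂`. [folklore] -/
def defect (φ : Gamma0 N → ZMod 2) (γ : Gamma0 (2 * N)) : ZMod 2 :=
  φ (Gamma0.degeneracyConj N (2 * N) 1 (dvd_two_mul_one N) γ) + φ (Gamma0.degeneracyConj N (2 * N) 2 (dvd_two_mul_two N) γ)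

/-- the defect is additive. [folklore] -/
theorem isAdd_defect (φ : Gamma0 N → ZMod 2) (hadd : IsAdd φ) : IsAdd (defect φ) := by
  intro x y
  simp only [defect, map_mul]
  rw [hadd, hadd]
  ring

/-- the defect on an explicit matrix `(a, b; 2c, d)`, `N ∣ c`: `φ(a, b; 2c, d) + φ(a, 2b; c, d)`. [folklore] -/
theorem defect_g0Of (φ : Gamma0 N → ZMod 2) (a b c d : ℤ) (h : a * d - b * (2 * c) = 1) (hc : (N : ℤ) ∣ c)
    (hc2 : ((2 * N : ℕ) : ℤ) ∣ 2 * c) :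
    defect φ (g0Of a b (2 * c) d h hc2) =
      φ (g0Of a b (2 * c) d h (Dvd.dvd.mul_left hc 2)) + φ (g0Of a (2 * b) c d (by linear_combination h) hc) := by
  unfold defect
  rw [degeneracyConj_one_g0Of, degeneracyConj_two_g0Of (dvd_two_mul_two N) a b c d h hc2 hc]

variable (ζ : K) (hζ : 1 + ζ + ζ * ζ = 0)

/-- `η := σθ + ζ·θ` on `Γ₀(4N)`, `K`-valued. [folklore] -/
noncomputable def etaOf (φ : Gamma0 N → ZMod 2) (g : Gamma0 (2 * (2 * N))) : K :=
  ZMod.castHom (dvd_refl 2) K (defect φ (Gamma0.degeneracyConj (2 * N) (2 * (2 * N)) 2 (dvd_two_mul_two (2 * N)) g)) +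
    ζ * ZMod.castHom (dvd_refl 2) K (defect φ (Gamma0.degeneracyConj (2 * N) (2 * (2 * N)) 1 (dvd_two_mul_one (2 * N)) g))

/-- `η` is additive. [folklore] -/
theorem isAdd_etaOf (φ : Gamma0 N → ZMod 2) (hadd : IsAdd φ) : IsAdd (etaOf ζ φ) := by
  intro x y
  simp only [etaOf, map_mul, isAdd_defect φ hadd _ _, map_add]
  ring

include hζ in
/-- **`η` is a `ζ²`-eigenfunction of the 2-shift** when `φ` is 8-shift invariant (`1 + ζ + ζ² = 0`). [folklore] -/
theorem isShiftEigen_etaOf (φ : Gamma0 N → ZMod 2) (h8 : IsEightShiftInvariant φ) :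
    IsShiftEigen (ζ * ζ) (etaOf ζ φ) := by
  intro a b c d hdet hc
  -- `c = 4N c₁`
  obtain ⟨c₁, rfl⟩ : ∃ c₁, c = ((2 * (2 * N) : ℕ) : ℤ) * c₁ := hc
  -- name the four `φ`-values
  set C : ℤ := ((2 * (2 * N) : ℕ) : ℤ) * c₁ with hC
  have hC4 : C = 2 * (2 * (N * c₁)) := by rw [hC]; push_cast; ring
  have hdet' : a * d - b * (2 * (2 * (2 * (N * c₁)))) = 1 := by rw [← hC4]; exact hdet
  -- left side: `η(a, 2b; C, d)`
  have eL : etaOf ζ φ (g0Of a (2 * b) C d (by linear_combination hdet) ⟨c₁, rfl⟩) =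
      ZMod.castHom (dvd_refl 2) K (φ (g0Of a (2 * (2 * b)) (2 * (N * c₁)) d (by linear_combination hdet') ⟨2 * c₁, by ring⟩) +
        φ (g0Of a (2 * (2 * (2 * b))) (N * c₁) d (by linear_combination hdet') ⟨c₁, rfl⟩)) +
      ζ * ZMod.castHom (dvd_refl 2) K (φ (g0Of a (2 * b) (2 * (2 * (N * c₁))) d (by linear_combination hdet')
          ⟨2 * (2 * c₁), by ring⟩) +
        φ (g0Of a (2 * (2 * b)) (2 * (N * c₁)) d (by linear_combination hdet') ⟨2 * c₁, by ring⟩)) := by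
    unfold etaOf
    have eM : (g0Of a (2 * b) C d (by linear_combination hdet) ⟨c₁, rfl⟩ : Gamma0 (2 * (2 * N))) =
        g0Of a (2 * b) (2 * (2 * (N * c₁))) d (by linear_combination hdet') ⟨c₁, by push_cast; ring⟩ :=
      g0Of_congr rfl rfl hC4 rfl _ _ _ _
    rw [eM, degeneracyConj_two_g0Of (dvd_two_mul_two (2 * N)) a (2 * b) (2 * (N * c₁)) d (by linear_combination hdet') _
        ⟨c₁, by push_cast; ring⟩,
      degeneracyConj_one_g0Of (dvd_two_mul_one (2 * N)) a (2 * b) _ d _ _ ⟨2 * c₁, by push_cast; ring⟩,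
      defect_g0Of φ a (2 * (2 * b)) (N * c₁) d (by linear_combination hdet') ⟨c₁, rfl⟩,
      defect_g0Of φ a (2 * b) (2 * (N * c₁)) d (by linear_combination hdet') ⟨2 * c₁, by ring⟩]
  -- right side: `η(a, b; 2C, d)`
  have eR : etaOf ζ φ (g0Of a b (2 * C) d hdet (Dvd.dvd.mul_left ⟨c₁, rfl⟩ 2)) =
      ZMod.castHom (dvd_refl 2) K (φ (g0Of a (2 * b) (2 * (2 * (N * c₁))) d (by linear_combination hdet')
          ⟨2 * (2 * c₁), by ring⟩) +
        φ (g0Of a (2 * (2 * b)) (2 * (N * c₁)) d (by linear_combination hdet') ⟨2 * c₁, by ring⟩)) +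
      ζ * ZMod.castHom (dvd_refl 2) K (φ (g0Of a b (2 * (2 * (2 * (N * c₁)))) d hdet' ⟨2 * (2 * (2 * c₁)), by ring⟩) +
        φ (g0Of a (2 * b) (2 * (2 * (N * c₁))) d (by linear_combination hdet') ⟨2 * (2 * c₁), by ring⟩)) := by
    unfold etaOf
    have eM : (g0Of a b (2 * C) d hdet (Dvd.dvd.mul_left ⟨c₁, rfl⟩ 2) : Gamma0 (2 * (2 * N))) =
        g0Of a b (2 * (2 * (2 * (N * c₁)))) d hdet' ⟨2 * c₁, by push_cast; ring⟩ :=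
      g0Of_congr rfl rfl (by rw [hC4]) rfl _ _ _ _
    rw [eM, degeneracyConj_two_g0Of (dvd_two_mul_two (2 * N)) a b (2 * (2 * (N * c₁))) d hdet' _
        ⟨2 * c₁, by push_cast; ring⟩,
      degeneracyConj_one_g0Of (dvd_two_mul_one (2 * N)) a b _ d _ _ ⟨2 * (2 * c₁), by push_cast; ring⟩,
      defect_g0Of φ a (2 * b) (2 * (N * c₁)) d (by linear_combination hdet') ⟨2 * c₁, by ring⟩,
      defect_g0Of φ a b (2 * (2 * (N * c₁))) d hdet' ⟨2 * (2 * c₁), by ring⟩]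
  -- the 8-shift invariance: `φ(a, 8b; Nc₁, d) = φ(a, b; 8Nc₁, d)`
  have h8' : φ (g0Of a (2 * (2 * (2 * b))) (N * c₁) d (by linear_combination hdet') ⟨c₁, rfl⟩) =
      φ (g0Of a b (2 * (2 * (2 * (N * c₁)))) d hdet' ⟨2 * (2 * (2 * c₁)), by ring⟩) := by
    have e1 : (g0Of a (2 * (2 * (2 * b))) (N * c₁) d (by linear_combination hdet') ⟨c₁, rfl⟩ : Gamma0 N) =
        g0Of a (8 * b) (N * c₁) d (by linear_combination hdet') ⟨c₁, rfl⟩ := g0Of_congr rfl (by ring) rfl rfl _ _ _ _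
    have e2 : (g0Of a b (2 * (2 * (2 * (N * c₁)))) d hdet' ⟨2 * (2 * (2 * c₁)), by ring⟩ : Gamma0 N) =
        g0Of a b (8 * (N * c₁)) d (by linear_combination hdet') ⟨8 * c₁, by ring⟩ := g0Of_congr rfl rfl (by ring) rfl _ _ _ _
    rw [e1, e2]
    exact h8 a b (N * c₁) d (by linear_combination hdet') ⟨c₁, rfl⟩
  rw [eL, eR, h8']
  -- the three remaining values `A = φ(a,4b;2c)`, `B = φ(a,b;8c)`, `C = φ(a,2b;4c)` read in `K`:
  -- `(A + B) + ζ(C + A) = ζ²((C + A) + ζ(B + C))` from `1 + ζ + ζ² = 0` and `2 = 0`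
  have h2 : (2 : K) = 0 := CharTwo.two_eq_zero
  have key : ∀ A B C : K, (A + B) + ζ * (C + A) = ζ * ζ * ((C + A) + ζ * (B + C)) := by
    intro A B C
    linear_combination (A + B * (1 - ζ) - ζ * C) * hζ + (-(ζ * ζ * A) + ζ * C) * h2
  simp only [map_add]
  exact key _ _ _

/-- an `𝔽₂`-value read in `K`: `ι x + ζ·ι y = 0` with `ζ ≠ 0, 1` forces `x = y = 0`. [folklore] -/
theorem eq_zero_of_iota_add_zeta_mul (hζ0 : ζ ≠ 0) (hζ1 : ζ ≠ 1) (x y : ZMod 2)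
    (h : ZMod.castHom (dvd_refl 2) K x + ζ * ZMod.castHom (dvd_refl 2) K y = 0) : x = 0 ∧ y = 0 := by
  have h2 : (2 : K) = 0 := CharTwo.two_eq_zero
  have h01 : ∀ z : ZMod 2, z = 0 ∨ z = 1 := by decide
  have hx := h01 x
  have hy := h01 y
  rcases hx with rfl | rfl <;> rcases hy with rfl | rfl
  · exact ⟨rfl, rfl⟩
  · exfalso; apply hζ0; rw [map_zero, map_one, zero_add, mul_one] at h; exact h
  · exfalso; rw [map_one, map_zero, mul_zero, add_zero] at h; exact one_ne_zero h
  · exfalso; apply hζ1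
    rw [map_one, mul_one] at h
    linear_combination h - h2

include hζ in
/-- **THE ω-REDUCTION.**  `K₂(N) = D(N)` and `K^{ζ²}(4N) = 0` (for `1 + ζ + ζ² = 0`) give `K₈(N) = D(N)`. [folklore] -/
theorem eightShift_isDiamond_of (hG2 : TwoShiftInvariantIsDiamondAt N) (hEig : ShiftEigenTrivialAt (2 * (2 * N)) (ζ * ζ))
    (φ : Gamma0 N → ZMod 2) (hadd : IsAdd φ) (h8 : IsEightShiftInvariant φ) : IsDiamond φ := by
  have hζ0 : ζ ≠ 0 := by rintro rfl; simp at hζ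
  have hζ1 : ζ ≠ 1 := by
    rintro rfl
    have h2 : (2 : K) = 0 := CharTwo.two_eq_zero
    have : (1 : K) = 0 := by linear_combination hζ - h2
    exact one_ne_zero this
  -- `η = 0`
  have hη : ∀ g, etaOf ζ φ g = 0 := hEig (etaOf ζ φ) (isAdd_etaOf ζ φ hadd) (isShiftEigen_etaOf ζ hζ φ h8)
  -- the defect vanishes on `B = Γ₀(4N)` and on `A = {2 ∣ b}`
  have hθB : ∀ x ∈ subB N, defect φ x = 0 := by
    intro x hx
    obtain ⟨a, b, c, d, h, hc, hc4, rfl⟩ := exists_eq_of_mem_subB hx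
    have := (eq_zero_of_iota_add_zeta_mul ζ hζ0 hζ1 _ _ (hη (g0Of a b c d h hc4))).2
    rwa [degeneracyConj_one_g0Of] at this
  have hθA : ∀ x ∈ subA N, defect φ x = 0 := by
    intro x hx
    obtain ⟨a, b, c, d, h, hc, rfl⟩ := exists_eq_of_mem_subA hx
    have := (eq_zero_of_iota_add_zeta_mul ζ hζ0 hζ1 _ _ (hη (g0Of a b (2 * c) d (by linear_combination h) (dvd_two_mul hc)))).1
    rwa [degeneracyConj_two_g0Of (dvd_two_mul_two (2 * N)) a b c d (by linear_combination h) (dvd_two_mul hc) hc] at this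
  -- hence on all of `Γ₀(2N) = A·⟨T⟩`
  have hθ : ∀ g : Gamma0 (2 * N), defect φ g = 0 := by
    intro g
    have hA := hθA _ (mul_Tpow_neg_mem_subA g)
    have hT := hθB _ (Tpow_mem_subB (((g : SL(2, ℤ)) 0 0 : ℤ) * (g : SL(2, ℤ)) 0 1))
    have e : g = (g * Tpow (2 * N) 1 ^ (-(((g : SL(2, ℤ)) 0 0 : ℤ) * (g : SL(2, ℤ)) 0 1))) *
        Tpow (2 * N) (((g : SL(2, ℤ)) 0 0 : ℤ) * (g : SL(2, ℤ)) 0 1) := by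
      rw [← Tpow_one_zpow (m := N) (((g : SL(2, ℤ)) 0 0 : ℤ) * (g : SL(2, ℤ)) 0 1), mul_assoc, ← zpow_add,
        neg_add_cancel, zpow_zero, mul_one]
    rw [e, isAdd_defect φ hadd, hA, hT, add_zero]
  -- so `φ` is 2-shift invariant
  have h2inv : IsTwoShiftInvariant φ := by
    intro a b c d hdet hc
    have h0 := hθ (g0Of a b (2 * c) d hdet (dvd_two_mul' hc))
    rw [defect_g0Of φ a b c d hdet hc] at h0
    have key : ∀ x y : ZMod 2, x + y = 0 → y = x := by decide
    exact key _ _ h0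
  exact hG2 φ hadd h2inv
where
  /-- `2N ∣ 2c` from `N ∣ c` (local copy at level `N`). -/
  dvd_two_mul' {c : ℤ} (hc : (N : ℤ) ∣ c) : ((2 * N : ℕ) : ℤ) ∣ 2 * c := by
    obtain ⟨k, hk⟩ := hc; exact ⟨k, by rw [hk]; push_cast; ring⟩

end Omega

/-! ### §5. `𝔽₄` and G₈ at every level modulo the node -/

/-- **an element `ζ ∈ 𝔽₄ = GaloisField 2 2` with `1 + ζ + ζ² = 0`.** [folklore] -/
theorem exists_zeta_galoisField : ∃ ζ : GaloisField 2 2, 1 + ζ + ζ * ζ = 0 := by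
  haveI : Fintype (GaloisField 2 2) := Fintype.ofFinite _
  have hq : Fintype.card (GaloisField 2 2) = 4 := by
    rw [← Nat.card_eq_fintype_card]; exact GaloisField.card 2 2 two_ne_zero
  -- some `ζ ∉ {0, 1}`
  have hex : ∃ ζ : GaloisField 2 2, ζ ≠ 0 ∧ ζ ≠ 1 := by
    by_contra hno
    push Not at hno
    have hsurj : Function.Surjective (fun b : Bool => if b then (1 : GaloisField 2 2) else 0) := by
      intro x
      by_cases hx : x = 0
      · exact ⟨false, by simp [hx]⟩
      · exact ⟨true, by simp [(hno x hx)]⟩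
    have := Fintype.card_le_of_surjective _ hsurj
    rw [hq, Fintype.card_bool] at this
    omega
  obtain ⟨ζ, hζ0, hζ1⟩ := hex
  refine ⟨ζ, ?_⟩
  have h3 : ζ ^ 3 = 1 := by
    have := FiniteField.pow_card_sub_one_eq_one ζ hζ0
    rwa [hq] at this
  have hfac : (ζ - 1) * (1 + ζ + ζ * ζ) = ζ ^ 3 - 1 := by ring
  rw [h3, sub_self] at hfac
  rcases mul_eq_zero.mp hfac with h | h
  · exact absurd (sub_eq_zero.mp h) hζ1
  · exact h

/-- **G₈ at a level `N` ⟸ G₂ at `N` and the ω-part at `4N` (over `𝔽₄`).** [folklore] -/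
theorem eightShift_isDiamond_of_galoisField {N : ℕ} (hG2 : TwoShiftInvariantIsDiamondAt N)
    (hEig : ∀ ζ : GaloisField 2 2, 1 + ζ + ζ * ζ = 0 → ShiftEigenTrivialAt (2 * (2 * N)) (ζ * ζ))
    (φ : Gamma0 N → ZMod 2) (hadd : IsAdd φ) (h8 : IsEightShiftInvariant φ) : IsDiamond φ := by
  obtain ⟨ζ, hζ⟩ := exists_zeta_galoisField
  exact eightShift_isDiamond_of ζ hζ hG2 (hEig ζ hζ) φ hadd h8

/-- **G₈ `EightShiftInvariantIsDiamond` at EVERY level ⟸ the node `TwoShiftCubeStep`.** [folklore] -/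
theorem eightShiftInvariantIsDiamond_of_cube (hcube : TwoShiftCubeStep) : EightShiftInvariantIsDiamond := by
  intro N hN φ hadd h8
  refine eightShift_isDiamond_of_galoisField (twoShiftInvariantIsDiamond_of_cube hcube N hN) (fun ζ hζ => ?_) φ hadd h8
  have hζ0 : ζ ≠ 0 := by rintro rfl; simp at hζ
  have h2 : (2 : GaloisField 2 2) = 0 := CharTwo.two_eq_zero
  have hζ1 : ζ ≠ 1 := by
    rintro rfl
    exact one_ne_zero (show (1 : GaloisField 2 2) = 0 by linear_combination hζ - h2)
  have hε0 : ζ * ζ ≠ 0 := mul_ne_zero hζ0 hζ0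
  have hε1 : ζ * ζ ≠ 1 := by
    intro h1
    apply hζ1
    -- `ζ² = 1`, `1 + ζ + ζ² = 0` ⟹ `ζ = 2 = 0`?? no: `ζ = -(1 + ζ²) = -2 = 0` contradicts `ζ ≠ 0`; so derive via `hζ0`
    exfalso
    apply hζ0
    linear_combination hζ - h1 - (1 : GaloisField 2 2) * h2 + 0 * h1
  exact shiftEigenTrivialAt_of_cube hcube (ζ * ζ) hε0 hε1 (2 * (2 * N)) (by omega)

end TwoShift

end Summit.BirchSwinnertonDyer.BirchSwinnertonDyer.Theorems.ManinLocalTwoThree
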